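import Literature.MathematicalPhysics.KineticTheory.CollisionFluxMeanBound
import HarnessLib

/-!
# The one-window collision-flux inequality for a NON-stationary law on a general window

Topic `Literature/MathematicalPhysics/KineticTheory` (sequel of `CollisionFluxMeanBound`; consumer: the crux line `plaque-thinning-count-ld`
of `CollisionActivityTails`, stmt-AtomisticToContinuum-13734, stub `AbnormalFromEnvelope`: the tagged and the hot window activity are small
in mean under the TRUE, non-invariant, local Gibbs law). The mechanism is "expected marked collision sum over a window ≤ time integral of the
contact flux of the law at the current time" (Cercignani–Illner–Pulvirenti 1994 App. 4.A). The tree has this step for INVARIANT laws only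
(`lintegral_le_liminf_of_le_collisionSum`, `CollisionFluxMeanBound`; the sharp stationary identity `HardSphereCampbellFormula` is an undischarged
named fact). This file removes the invariance:

* `exists_measurable_majorant_collisionSum` — for a hard-sphere flow `Φ`, `τ > 0`, a start `s`, a mark `F ≥ 0`, measurable window
  events `E M i j ⊇ {(i,j) reaches contact under a backward free flight of duration ≤ τ/M}` and measurable majorants `Ft M ≥ F` along
  those flights, the collision sum `Σ_{collision times r ∈ [s, s+τ]} Σ_{ordered contact pairs} F(Φ_r z, i, j)` is dominated on the good
  set by a MEASURABLE grid functional `g` whose mean under ANY law `P` is at most `liminf_M Σ_{k=1}^{M} ∫ W_M d((Φ_{s+kτ/M})_* P)`,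
  `W_M = Σ_{i≠j} 𝟙_{E M i j} Ft M (·,i,j)` — the one-window functionals of the tree read under the LAWS AT THE GRID TIMES (pathwise
  grid bound `sum_collision_le_sum_window` for the orbit of `Φ_s z` below the gap of its collision times, `collisionTimes_flow_shift`;
  Fatou; change of variables `lintegral_map` for the measurable `W_M`);
* `exists_measurable_majorant_collisionSum_of_forall_le`, `lintegral_le_liminf_mul_of_le_collisionSum` — with a uniform-in-time
  one-window bound `B M` over the laws `(Φ_r)_* P`, `r ∈ [s, s + τ]` (supplied by static estimates on the transported densities, e.g. a
  marginal envelope at the times of the window), the mean is `≤ liminf_M M · B M`; for `B M = (τ/M) · Flux` this is `τ · Flux`.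
  Neither the dominated functional nor the collision sum need be measurable (the exported majorant is).

References: C. Cercignani, R. Illner, M. Pulvirenti, *The Mathematical Theory of Dilute Gases* (1994), §4.3, App. 4.A (special-flow
representation; collision sums along the hard-sphere flow); I. Gallagher, L. Saint-Raymond, B. Texier, *From Newton to Boltzmann*
(2013), Prop. 4.1.1. Elementary given the tree's pathwise grid bound; recorded here.
-/

noncomputable section

open MeasureTheory Set Filter Topology
open scoped ENNReal

namespace Literature.MathematicalPhysics.KineticTheory

open Literature.Analysis.FluidPDE

section WindowFlux

variable {d X : Type*} [Fintype d] [MeasureSpace X] [TopologicalSpace X] {G : Geometry d X} {ε : ℝ} {n : ℕ}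

/-- **Collision times of a shifted orbit**: for good `z`, `r` is a collision time of the orbit of `Φ_s z`
iff `r + s` is one of the orbit of `z` (group property on the good set). [folklore] -/
theorem collisionTimes_flow_shift (Φ : HardSphereFlow G ε n) {z : Config n d X} (hz : z ∈ Φ.good) (s : ℝ) :
    collisionTimes G ε (fun t => Φ.flow t (Φ.flow s z)) = (fun r => r + s) ⁻¹' collisionTimes G ε (fun t => Φ.flow t z) := by
  ext r
  simp only [mem_preimage, mem_collisionTimes]
  rw [← Φ.flow_add r s z hz]

/-- **Shifting a collision sum to the window `[0, τ]`**: for good `z`, a sum over the collision times of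
the orbit of `z` in `[s, s + τ]` of a function of the current configuration is the same sum over the
collision times of the orbit of `Φ_s z` in `[0, τ]`. [folklore] -/
theorem finsum_collisionTimes_shift {M : Type*} [AddCommMonoid M] (Φ : HardSphereFlow G ε n)
    {z : Config n d X} (hz : z ∈ Φ.good) (s τ : ℝ) (H : Config n d X → M) :
    ∑ᶠ r ∈ collisionTimes G ε (fun t => Φ.flow t z) ∩ Icc s (s + τ), H (Φ.flow r z) =
      ∑ᶠ r ∈ collisionTimes G ε (fun t => Φ.flow t (Φ.flow s z)) ∩ Icc 0 τ, H (Φ.flow r (Φ.flow s z)) := by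
  symm
  refine finsum_mem_eq_of_bijOn (fun r => r + s) ⟨?_, ?_, ?_⟩ fun r _ => by rw [← Φ.flow_add r s z hz]
  · rintro r ⟨hr, hr0, hrτ⟩
    rw [collisionTimes_flow_shift Φ hz s] at hr
    exact ⟨hr, by linarith, by linarith⟩
  · exact fun r _ r' _ h => by simpa using h
  · rintro u ⟨hu, hus, huτ⟩
    refine ⟨u - s, ⟨?_, by linarith, by linarith⟩, by ring⟩
    rw [collisionTimes_flow_shift Φ hz s, mem_preimage, sub_add_cancel]
    exact hu

/-- **The measurable grid majorant of a window collision sum (no stationarity, general window).** For a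
hard-sphere flow `Φ`, `τ > 0`, a start `s`, a mark `F ≥ 0`, measurable window events
`E M i j ⊇ {(i,j) reaches contact under a backward free flight of duration ≤ τ/M}` and measurable majorants
`Ft M ≥ F` along those flights, there is a MEASURABLE `g` dominating on the good set the collision sum
`Σ_{collision times r ∈ [s, s+τ]} Σ_{ordered contact pairs (i,j)} F(Φ_r z, i, j)` and whose mean under ANY
law `P` is at most `liminf_M Σ_{k=1}^{M} ∫ W_M d((Φ_{s + kτ/M})_* P)`, `W_M = Σ_{i≠j} 𝟙_{E M i j} Ft M (·,i,j)`
— the grid sums read under the LAWS AT THE GRID TIMES (`g = liminf_M Σ_k W_M ∘ Φ_{s+kτ/M}`; pathwise grid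
bound `sum_collision_le_sum_window` for the orbit of `Φ_s z` below the gap of its collision times, Fatou,
change of variables `lintegral_map` for the measurable window functionals). This is the special-flow /
Campbell inequality of Cercignani–Illner–Pulvirenti 1994 App. 4.A for a NON-stationary law, in the
one-window form of the tree (`lintegral_le_liminf_of_le_collisionSum` is the case `s = 0`, `(Φ_t)_* P = P`). [cite: CIP1994, App. 4.A] -/
theorem exists_measurable_majorant_collisionSum (Φ : HardSphereFlow G ε n) {τ : ℝ} (hτ : 0 < τ) (s : ℝ)
    (F : Config n d X → Fin n → Fin n → ℝ≥0∞)
    (E : ℕ → Fin n → Fin n → Set (Config n d X)) (hEm : ∀ M i j, MeasurableSet (E M i j))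
    (hE : ∀ (M : ℕ) (i j : Fin n), i ≠ j → ∀ w ∈ hardSphereDomain G n ε, ∀ t ∈ Icc 0 (τ / M),
      ‖G.sepVec ((freeFlight G (-t) w i).1) ((freeFlight G (-t) w j).1)‖ = ε → w ∈ E M i j)
    (Ft : ℕ → Config n d X → Fin n → Fin n → ℝ≥0∞) (hFtm : ∀ M i j, Measurable fun w => Ft M w i j)
    (hFt : ∀ (M : ℕ) (i j : Fin n), i ≠ j → ∀ w ∈ hardSphereDomain G n ε, ∀ t ∈ Icc 0 (τ / M),
      ‖G.sepVec ((freeFlight G (-t) w i).1) ((freeFlight G (-t) w j).1)‖ = ε →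
        F (freeFlight G (-t) w) i j ≤ Ft M w i j) :
    ∃ g : Config n d X → ℝ≥0∞, Measurable g ∧
      (∀ z ∈ Φ.good, ∑ᶠ r ∈ collisionTimes G ε (fun t => Φ.flow t z) ∩ Icc s (s + τ),
        ∑ i, ∑ j, (if i ≠ j ∧ ‖G.sepVec (Φ.flow r z i).1 (Φ.flow r z j).1‖ = ε
          then F (Φ.flow r z) i j else 0) ≤ g z) ∧
      ∀ P : Measure (Config n d X), ∫⁻ z, g z ∂P ≤
        liminf (fun M : ℕ => ∑ k ∈ Finset.Icc 1 M,
          ∫⁻ w, ∑ i, ∑ j, (if i ≠ j then (E M i j).indicator (fun w => Ft M w i j) w else 0)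
            ∂(P.map (Φ.flow ((k : ℝ) * (τ / M) + s)))) atTop := by
  classical
  -- adapted from `lintegral_le_liminf_of_le_collisionSum` (`CollisionFluxMeanBound`): window shifted to
  -- `[s, s + τ]` through the orbit of `Φ_s z`; stationarity ↦ `lintegral_map`; the majorant is exported
  set W : ℕ → Config n d X → ℝ≥0∞ := fun M w => ∑ i, ∑ j,
    (if i ≠ j then (E M i j).indicator (fun w => Ft M w i j) w else 0) with hWdef
  have hWm : ∀ M, Measurable (W M) := by
    intro M
    refine Finset.measurable_sum _ fun i _ => Finset.measurable_sum _ fun j _ => ?_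
    by_cases hij : i ≠ j
    · simp only [if_pos hij]
      exact (hFtm M i j).indicator (hEm M i j)
    · simp only [if_neg hij]
      exact measurable_const
  set SM : ℕ → Config n d X → ℝ≥0∞ := fun M z =>
    ∑ k ∈ Finset.Icc 1 M, W M (Φ.flow ((k : ℝ) * (τ / M) + s) z) with hSMdef
  have hSMm : ∀ M, Measurable (SM M) := fun M =>
    Finset.measurable_sum _ fun k _ => (hWm M).comp (Φ.measurable_flow _)
  refine ⟨fun z => liminf (fun M => SM M z) atTop, Measurable.liminf hSMm, fun z hz => ?_, fun P => ?_⟩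
  · -- (i) the pathwise bound on the good set, for the orbit of `Φ_s z`
    have hz' : Φ.flow s z ∈ Φ.good := Φ.mapsTo_good s hz
    rw [finsum_collisionTimes_shift Φ hz s τ (fun w => ∑ i, ∑ j,
      (if i ≠ j ∧ ‖G.sepVec (w i).1 (w j).1‖ = ε then F w i j else 0))]
    have hγ := Φ.isTrajectory _ hz'
    have hfin := hγ.locFinite 0 τ
    rw [finsum_mem_eq_finite_toFinset_sum _ hfin]
    obtain ⟨g, hg, hgap⟩ := exists_gap_of_finite hfin
    refine le_liminf_of_le (h := ?_)
    filter_upwards [eventually_gt_atTop ⌈τ / g⌉₊] with M hM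
    have hM0 : 0 < M := lt_of_le_of_lt (Nat.zero_le _) hM
    have hMg : τ / M < g := by
      have h1 : τ / g < M := (Nat.le_ceil _).trans_lt (by exact_mod_cast hM)
      rw [div_lt_iff₀ hg] at h1
      rw [div_lt_iff₀ (by exact_mod_cast hM0)]
      linarith
    have hgap' : ∀ r ∈ collisionTimes G ε (fun t => Φ.flow t (Φ.flow s z)) ∩ Icc 0 τ,
        ∀ r' ∈ collisionTimes G ε (fun t => Φ.flow t (Φ.flow s z)) ∩ Icc 0 τ, r < r' → τ / M < r' - r :=
      fun r hr r' hr' hlt => hMg.trans_le (hgap r hr r' hr' hlt)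
    refine (sum_collision_le_sum_window hγ hτ hM0 hgap' (E M) (hE M) F (Ft M) (hFt M)).trans (le_of_eq ?_)
    refine Finset.sum_congr rfl fun k _ => ?_
    simp only [hWdef, Φ.flow_add _ s z hz]
  · -- (ii) the mean of each grid sum under the laws at the grid times, (iii) Fatou
    have hmeanM : ∀ M, ∫⁻ z, SM M z ∂P =
        ∑ k ∈ Finset.Icc 1 M, ∫⁻ w, W M w ∂(P.map (Φ.flow ((k : ℝ) * (τ / M) + s))) := by
      intro M
      calc ∫⁻ z, SM M z ∂P = ∑ k ∈ Finset.Icc 1 M, ∫⁻ z, W M (Φ.flow ((k : ℝ) * (τ / M) + s) z) ∂P :=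
            lintegral_finsetSum _ fun k _ => (hWm M).comp (Φ.measurable_flow _)
        _ = ∑ k ∈ Finset.Icc 1 M, ∫⁻ w, W M w ∂(P.map (Φ.flow ((k : ℝ) * (τ / M) + s))) :=
            Finset.sum_congr rfl fun k _ => (lintegral_map (hWm M) (Φ.measurable_flow _)).symm
    calc ∫⁻ z, liminf (fun M => SM M z) atTop ∂P
        ≤ liminf (fun M : ℕ => ∫⁻ z, SM M z ∂P) atTop := lintegral_liminf_le hSMm
      _ = _ := congrArg (fun u : ℕ → ℝ≥0∞ => liminf u atTop) (funext hmeanM)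

/-- **Uniform-in-time one-window bounds integrate to a flux bound.** In the situation of
`exists_measurable_majorant_collisionSum`, if the one-window functional `W_M` has mean at most `B M` under
EVERY law `(Φ_r)_* P`, `r ∈ [s, s + τ]` (a bound supplied by static estimates on the laws at the times of the
window, e.g. marginal envelopes of their densities), then the measurable majorant `g` of the window collision
sum has `∫ g dP ≤ liminf_M M · B M` — for one-window bounds linear in the mesh, `B M = (τ/M) · Flux`, this is
`τ · Flux`, the time integral of the contact flux; and so has every `f ≥ 0` dominated by the collision sum on
the good set, when `P` is carried by the good set. Neither `f` nor the collision sum need be measurable. [cite: CIP1994, App. 4.A] -/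
theorem exists_measurable_majorant_collisionSum_of_forall_le (Φ : HardSphereFlow G ε n)
    (P : Measure (Config n d X)) {τ : ℝ} (hτ : 0 < τ) (s : ℝ)
    (F : Config n d X → Fin n → Fin n → ℝ≥0∞)
    (E : ℕ → Fin n → Fin n → Set (Config n d X)) (hEm : ∀ M i j, MeasurableSet (E M i j))
    (hE : ∀ (M : ℕ) (i j : Fin n), i ≠ j → ∀ w ∈ hardSphereDomain G n ε, ∀ t ∈ Icc 0 (τ / M),
      ‖G.sepVec ((freeFlight G (-t) w i).1) ((freeFlight G (-t) w j).1)‖ = ε → w ∈ E M i j)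
    (Ft : ℕ → Config n d X → Fin n → Fin n → ℝ≥0∞) (hFtm : ∀ M i j, Measurable fun w => Ft M w i j)
    (hFt : ∀ (M : ℕ) (i j : Fin n), i ≠ j → ∀ w ∈ hardSphereDomain G n ε, ∀ t ∈ Icc 0 (τ / M),
      ‖G.sepVec ((freeFlight G (-t) w i).1) ((freeFlight G (-t) w j).1)‖ = ε →
        F (freeFlight G (-t) w) i j ≤ Ft M w i j)
    (B : ℕ → ℝ≥0∞)
    (hB : ∀ (M : ℕ), ∀ r ∈ Icc s (s + τ),
      ∫⁻ w, ∑ i, ∑ j, (if i ≠ j then (E M i j).indicator (fun w => Ft M w i j) w else 0)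
        ∂(P.map (Φ.flow r)) ≤ B M) :
    ∃ g : Config n d X → ℝ≥0∞, Measurable g ∧
      (∀ z ∈ Φ.good, ∑ᶠ r ∈ collisionTimes G ε (fun t => Φ.flow t z) ∩ Icc s (s + τ),
        ∑ i, ∑ j, (if i ≠ j ∧ ‖G.sepVec (Φ.flow r z i).1 (Φ.flow r z j).1‖ = ε
          then F (Φ.flow r z) i j else 0) ≤ g z) ∧
      ∫⁻ z, g z ∂P ≤ liminf (fun M : ℕ => (M : ℝ≥0∞) * B M) atTop := by
  obtain ⟨g, hgm, hdom, hint⟩ := exists_measurable_majorant_collisionSum Φ hτ s F E hEm hE Ft hFtm hFt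
  refine ⟨g, hgm, hdom, (hint P).trans (liminf_le_liminf (Eventually.of_forall fun M => ?_))⟩
  calc ∑ k ∈ Finset.Icc 1 M, ∫⁻ w, ∑ i, ∑ j, (if i ≠ j then (E M i j).indicator (fun w => Ft M w i j) w else 0)
          ∂(P.map (Φ.flow ((k : ℝ) * (τ / M) + s)))
      ≤ ∑ _k ∈ Finset.Icc 1 M, B M := Finset.sum_le_sum fun k hk => hB M _ ?_
    _ = (M : ℝ≥0∞) * B M := by rw [Finset.sum_const, Nat.card_Icc, Nat.add_sub_cancel, nsmul_eq_mul]
  -- the grid time `s + k τ / M` lies in `[s, s + τ]` for `1 ≤ k ≤ M`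
  rw [Finset.mem_Icc] at hk
  have hM : (0 : ℝ) < M := by exact_mod_cast hk.1.trans hk.2
  have hkM : (k : ℝ) ≤ M := by exact_mod_cast hk.2
  have h0 : 0 ≤ (k : ℝ) * (τ / M) := by positivity
  have h1 : (k : ℝ) * (τ / M) ≤ τ :=
    calc (k : ℝ) * (τ / M) ≤ M * (τ / M) := by gcongr
      _ = τ := by field_simp
  exact ⟨by linarith, by linarith⟩

/-- **Functionals dominated by a window collision sum, under a law carried by the good set**: in the
situation of `exists_measurable_majorant_collisionSum_of_forall_le`, every `f ≥ 0` (measurable or not)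
dominated on the good set by the collision sum over `[s, s + τ]` has `∫ f dP ≤ liminf_M M · B M`. [cite: CIP1994, App. 4.A] -/
theorem lintegral_le_liminf_mul_of_le_collisionSum (Φ : HardSphereFlow G ε n)
    (P : Measure (Config n d X)) (hP : P Φ.goodᶜ = 0) {τ : ℝ} (hτ : 0 < τ) (s : ℝ)
    (F : Config n d X → Fin n → Fin n → ℝ≥0∞)
    (E : ℕ → Fin n → Fin n → Set (Config n d X)) (hEm : ∀ M i j, MeasurableSet (E M i j))
    (hE : ∀ (M : ℕ) (i j : Fin n), i ≠ j → ∀ w ∈ hardSphereDomain G n ε, ∀ t ∈ Icc 0 (τ / M),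
      ‖G.sepVec ((freeFlight G (-t) w i).1) ((freeFlight G (-t) w j).1)‖ = ε → w ∈ E M i j)
    (Ft : ℕ → Config n d X → Fin n → Fin n → ℝ≥0∞) (hFtm : ∀ M i j, Measurable fun w => Ft M w i j)
    (hFt : ∀ (M : ℕ) (i j : Fin n), i ≠ j → ∀ w ∈ hardSphereDomain G n ε, ∀ t ∈ Icc 0 (τ / M),
      ‖G.sepVec ((freeFlight G (-t) w i).1) ((freeFlight G (-t) w j).1)‖ = ε →
        F (freeFlight G (-t) w) i j ≤ Ft M w i j)
    (B : ℕ → ℝ≥0∞)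
    (hB : ∀ (M : ℕ), ∀ r ∈ Icc s (s + τ),
      ∫⁻ w, ∑ i, ∑ j, (if i ≠ j then (E M i j).indicator (fun w => Ft M w i j) w else 0)
        ∂(P.map (Φ.flow r)) ≤ B M)
    (f : Config n d X → ℝ≥0∞)
    (hf : ∀ z ∈ Φ.good, f z ≤ ∑ᶠ r ∈ collisionTimes G ε (fun t => Φ.flow t z) ∩ Icc s (s + τ),
        ∑ i, ∑ j, (if i ≠ j ∧ ‖G.sepVec (Φ.flow r z i).1 (Φ.flow r z j).1‖ = ε
          then F (Φ.flow r z) i j else 0)) :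
    ∫⁻ z, f z ∂P ≤ liminf (fun M : ℕ => (M : ℝ≥0∞) * B M) atTop := by
  obtain ⟨g, -, hdom, hint⟩ :=
    exists_measurable_majorant_collisionSum_of_forall_le Φ P hτ s F E hEm hE Ft hFtm hFt B hB
  have hae : ∀ᵐ z ∂P, f z ≤ g z := by
    have h : ∀ᵐ z ∂P, z ∈ Φ.good := by
      rw [ae_iff]
      exact hP
    filter_upwards [h] with z hz using (hf z hz).trans (hdom z hz)
  exact (lintegral_mono_ae hae).trans hint

end WindowFlux

end Literature.MathematicalPhysics.KineticTheory

end
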